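import Mathlib.Analysis.Calculus.LocalExtr.Polynomial
import Mathlib.Analysis.Calculus.Deriv.MeanValue
import Mathlib.Analysis.Polynomial.Basic
import Summits.ValiantsHypothesis.ValiantsHypothesis.Theorems.LacunarySymmetroidMatrixDescartesCensusTwistedRolle

/-!
# `MatrixDescartes` census — the TOP-KILL refinement of the twisted Rolle inequality (kernel version)

HONEST FRAMING.  Object-search cell `pub-symmetroid`, route crux `Theses.LacunarySymmetroid.MatrixDescartes`
(ledger item stmt-ValiantsHypothesis-18050).  Companion of `…CensusEndKill.lean` (the bottom end) and of the tree's
twisted Rolle inequality `Census.card_posRoots_le_card_posRoots_twist_succ` (`#Z₊(f) ≤ #Z₊(X f′ − E f) + 1` for any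
weight `E`): at the TOP weight `E = natDegree f` the `+ 1` disappears whenever the two HIGHEST coefficients of `f`
have the same sign — the «top kill» of the cell's window theorems (theory-2 g14 THEOREM N′: «top kill by x ↦ 1/x»),
proved here directly: `f(x)/xⁿ` vanishes at the largest positive root, overshoots its limit `leadingCoeff f` (because
the next coefficient has the same sign) and comes back, which costs `X f′ − n f` a root beyond the largest root of `f`.

* `hasDerivAt_eval_div_pow` — `(f/Xⁿ)′ = (X f′ − n f)/X^{n+1}` on `x ≠ 0`;
* `exists_forall_ge_eval_pos` — a polynomial with positive leading coefficient is eventually positive;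
* `card_posRoots_le_card_posRoots_topTwist_of_topKill` — `n = natDegree f ≥ m ≥ 1`, `f.coeff j = 0` for
  `n − m < j < n`, `leadingCoeff f · f.coeff (n − m) > 0` ⇒ `#Z₊(f) ≤ #Z₊(X·f′ − n·f)`.
Nothing here bears on `ζ_sym`, `DoorA26` / `DoorA34`, the crux, or `VP ≠ VNP`.

[folklore] Mean value theorem twice, intermediate value theorem once, `Finset.card_le_sdiff_of_interleaved`.
-/

-- `Summit.ValiantsHypothesis.ValiantsHypothesis.…` repeats a component by the D-0017 layout
-- (single-conjunct summit), which the `dupNamespace` linter flags; the name is mandated.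
set_option linter.dupNamespace false

namespace Summit.ValiantsHypothesis.ValiantsHypothesis.Theorems.LacunarySymmetroidMatrixDescartes.Census

open Polynomial Finset Set
open scoped BigOperators Polynomial


/-- Derivative of `u ↦ f(u)/uⁿ` (`n ≥ 1`, `u ≠ 0`): `(X·f′ − n·f)(u) / u^{n+1}`. [folklore] -/
theorem hasDerivAt_eval_div_pow (f : ℝ[X]) {n : ℕ} (hn : 1 ≤ n) {x : ℝ} (hx : x ≠ 0) :
    HasDerivAt (fun u => f.eval u / u ^ n) ((X * derivative f - C (n : ℝ) * f).eval x / x ^ (n + 1)) x := by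
  have h1 : HasDerivAt (fun u => f.eval u) (f.derivative.eval x) x := f.hasDerivAt x
  have h2 : HasDerivAt (fun u : ℝ => u ^ n) ((n : ℝ) * x ^ (n - 1)) x := hasDerivAt_pow n x
  have h := h1.div h2 (pow_ne_zero n hx)
  refine h.congr_deriv ?_
  obtain ⟨k, rfl⟩ : ∃ k, n = k + 1 := ⟨n - 1, by omega⟩
  rw [Nat.add_sub_cancel, eval_sub, eval_mul, eval_X, eval_mul, eval_C]
  push_cast
  field_simp
  ring

/-- A non-zero real polynomial with positive leading coefficient is eventually positive. [folklore] -/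
theorem exists_forall_ge_eval_pos (p : ℝ[X]) (hp : 0 < p.leadingCoeff) :
    ∃ M : ℝ, ∀ x, M ≤ x → 0 < p.eval x := by
  by_cases hdeg : 0 < p.degree
  · have ht := Polynomial.tendsto_atTop_of_leadingCoeff_nonneg p hdeg hp.le
    obtain ⟨M, hM⟩ := (ht.eventually_gt_atTop 0).exists_forall_of_atTop
    exact ⟨M, hM⟩
  · -- degree ≤ 0: `p` is the constant `p.leadingCoeff > 0`
    have hp0 : p ≠ 0 := by intro h0; rw [h0, leadingCoeff_zero] at hp; exact lt_irrefl 0 hp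
    have hnat : p.natDegree = 0 := by
      rw [not_lt] at hdeg
      exact natDegree_eq_zero_iff_degree_le_zero.mpr hdeg
    refine ⟨0, fun x _ => ?_⟩
    rw [eq_C_of_natDegree_eq_zero hnat, eval_C]
    have : p.leadingCoeff = p.coeff 0 := by rw [leadingCoeff, hnat]
    rw [← this]; exact hp

/-- **TOP-KILL LEMMA (positive normalisation).**  `n = natDegree f ≥ m ≥ 1`, `f.coeff j = 0` for
`n − m < j < n`, `f.leadingCoeff > 0`, `f.coeff (n − m) > 0` ⇒ `#Z₊(f) ≤ #Z₊(X·f′ − n·f)`. [folklore] -/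
theorem card_posRoots_le_card_posRoots_topTwist_of_topKill_pos (f : ℝ[X]) {m : ℕ} (hm : 1 ≤ m)
    (hmn : m ≤ f.natDegree) (hgap : ∀ j, f.natDegree - m < j → j < f.natDegree → f.coeff j = 0)
    (ha : 0 < f.leadingCoeff) (hb : 0 < f.coeff (f.natDegree - m)) :
    (f.roots.toFinset.filter (fun x => 0 < x)).card ≤
      ((X * derivative f - C (f.natDegree : ℝ) * f).roots.toFinset.filter (fun x => 0 < x)).card := by
  set n := f.natDegree with hn
  have hn1 : 1 ≤ n := hm.trans hmn
  have hf : f ≠ 0 := fun h0 => by rw [h0, leadingCoeff_zero] at ha; exact lt_irrefl 0 ha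
  set g : ℝ[X] := X * derivative f - C (n : ℝ) * f with hg
  -- `g.coeff (n - m) = -m · f.coeff (n-m) ≠ 0`, so `g ≠ 0`
  have hgc : g.coeff (n - m) = (((n - m : ℕ) : ℝ) - n) * f.coeff (n - m) := by
    rw [hg, coeff_X_mul_derivative_sub_C_mul]
  have hgne : g ≠ 0 := by
    intro h0
    rw [h0, coeff_zero] at hgc
    have : (((n - m : ℕ) : ℝ) - n) * f.coeff (n - m) ≠ 0 := by
      apply mul_ne_zero _ hb.ne'
      have : ((n - m : ℕ) : ℝ) = (n : ℝ) - m := by push_cast [Nat.cast_sub hmn]; ring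
      rw [this]
      have : (0 : ℝ) < m := by exact_mod_cast hm
      linarith
    exact this hgc.symm
  set s := f.roots.toFinset.filter (fun x => 0 < x) with hs
  set t := g.roots.toFinset.filter (fun x => 0 < x) with ht
  have hmem_s : ∀ x, x ∈ s ↔ f.IsRoot x ∧ 0 < x := by
    intro x; rw [hs, Finset.mem_filter, Multiset.mem_toFinset, mem_roots hf]
  have hmem_t : ∀ x, x ∈ t ↔ g.IsRoot x ∧ 0 < x := by
    intro x; rw [ht, Finset.mem_filter, Multiset.mem_toFinset, mem_roots hgne]
  -- the quotient `φ = f / Xⁿ` and its derivative `g / X^{n+1}` on `(0, ∞)`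
  set φ : ℝ → ℝ := fun u => f.eval u / u ^ n with hφ
  have hφderiv : ∀ x, 0 < x → HasDerivAt φ (g.eval x / x ^ (n + 1)) x :=
    fun x hx => hasDerivAt_eval_div_pow f hn1 hx.ne'
  have hφcont : ∀ a b, 0 < a → ContinuousOn φ (Icc a b) := by
    intro a b ha' x hx
    exact ((hφderiv x (lt_of_lt_of_le ha' hx.1)).continuousAt).continuousWithinAt
  have hφdiff : ∀ a b, 0 < a → DifferentiableOn ℝ φ (Ioo a b) := by
    intro a b ha' x hx
    exact ((hφderiv x (ha'.trans hx.1)).differentiableAt).differentiableWithinAt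
  -- Rolle between consecutive positive roots: a root of `g`
  have rolle : ∀ x y, 0 < x → x < y → f.eval x = 0 → f.eval y = 0 → ∃ z, x < z ∧ z < y ∧ g.IsRoot z := by
    intro x y hx hxy hfx hfy
    have hφx : φ x = 0 := by simp only [hφ, hfx, zero_div]
    have hφy : φ y = 0 := by simp only [hφ, hfy, zero_div]
    obtain ⟨c, hc, hcd⟩ := exists_deriv_eq_zero hxy (hφcont x y hx) (hφx.trans hφy.symm)
    have hc0 : 0 < c := hx.trans hc.1
    have hd := (hφderiv c hc0).deriv
    rw [hcd] at hd
    have : g.eval c = 0 := by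
      have hx1 : c ^ (n + 1) ≠ 0 := pow_ne_zero _ hc0.ne'
      field_simp at hd
      linarith [hd]
    exact ⟨c, hc.1, hc.2, this⟩
  by_cases hse : s = ∅
  · rw [hse, Finset.card_empty]; exact Nat.zero_le _
  -- the largest positive root `r`
  obtain ⟨r, hr⟩ : s.Nonempty := Finset.nonempty_iff_ne_empty.mpr hse
  set r := s.max' ⟨r, hr⟩ with hrdef
  have hrs : r ∈ s := Finset.max'_mem _ _
  have hrroot : f.IsRoot r := ((hmem_s r).mp hrs).1
  have hr0 : 0 < r := ((hmem_s r).mp hrs).2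
  have hrmax : ∀ x ∈ s, x ≤ r := fun x hx => Finset.le_max' _ _ hx
  -- (A) `f > 0` on `(r, ∞)`
  obtain ⟨M₁, hM₁⟩ := exists_forall_ge_eval_pos f ha
  have fpos : ∀ y, r < y → 0 < f.eval y := by
    intro y hy
    by_contra hle
    rw [not_lt] at hle
    -- a root in `[y, max y M₁]` by the intermediate value theorem
    set y₁ := max y M₁ with hy₁
    have hyy₁ : y ≤ y₁ := le_max_left _ _
    have hfy₁ : 0 < f.eval y₁ := hM₁ y₁ (le_max_right _ _)
    have hcont : ContinuousOn (fun u => f.eval u) (Icc y y₁) := f.continuousOn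
    have hmem : (0 : ℝ) ∈ Icc (f.eval y) (f.eval y₁) := ⟨hle, hfy₁.le⟩
    obtain ⟨c, hc, hfc⟩ := intermediate_value_Icc hyy₁ hcont hmem
    have hcs : c ∈ s := (hmem_s c).mpr ⟨hfc, hr0.trans (lt_of_lt_of_le hy hc.1)⟩
    have := hrmax c hcs
    linarith [hc.1]
  -- (B) a point `ξ > r` with `g(ξ) > 0` (MVT for `φ` on `[r, r+1]`)
  have hφr : φ r = 0 := by simp only [hφ]; rw [hrroot.eq_zero, zero_div]
  obtain ⟨ξ, hξ, hξslope⟩ := exists_deriv_eq_slope φ (by linarith : r < r + 1) (hφcont r (r + 1) hr0)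
    (hφdiff r (r + 1) hr0)
  have hξ0 : 0 < ξ := hr0.trans hξ.1
  have hgξ : 0 < g.eval ξ := by
    have hφr1 : 0 < φ (r + 1) := by
      simp only [hφ]; exact div_pos (fpos (r + 1) (by linarith)) (pow_pos (by linarith) n)
    have hd := (hφderiv ξ hξ0).deriv
    rw [hξslope, hφr, sub_zero, add_sub_cancel_left, div_one] at hd
    -- `φ (r+1) = g ξ / ξ^(n+1)`
    have hx1 : 0 < ξ ^ (n + 1) := pow_pos hξ0 _
    have : g.eval ξ = φ (r + 1) * ξ ^ (n + 1) := by
      field_simp at hd; linarith [hd]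
    rw [this]; exact mul_pos hφr1 hx1
  -- (C) a point `η > ξ` with `g(η) < 0`: `φ` overshoots `a = leadingCoeff f` and comes back
  -- `φ x - a = (eraseLead f)(x) / x^n`, `eraseLead f` has positive leading coefficient `f.coeff (n-m)`
  have hEdeg : f.eraseLead.natDegree ≤ n - m := by
    rw [natDegree_le_iff_coeff_eq_zero]
    intro j hj
    by_cases hjn : j < n
    · rw [eraseLead_coeff_of_ne j (by omega)]; exact hgap j hj hjn
    · by_cases hjn' : j = n
      · rw [hjn']; exact eraseLead_coeff_natDegree
      · rw [eraseLead_coeff_of_ne j hjn']; exact coeff_eq_zero_of_natDegree_lt (by omega)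
  have hEc : f.eraseLead.coeff (n - m) = f.coeff (n - m) := eraseLead_coeff_of_ne _ (by omega)
  have hEdeg' : f.eraseLead.natDegree = n - m :=
    natDegree_eq_of_le_of_coeff_ne_zero hEdeg (by rw [hEc]; exact hb.ne')
  have hElead : 0 < f.eraseLead.leadingCoeff := by rw [leadingCoeff, hEdeg', hEc]; exact hb
  have hφa : ∀ x, 0 < x → φ x - f.leadingCoeff = f.eraseLead.eval x / x ^ n := by
    intro x hx
    have hxn : x ^ n ≠ 0 := pow_ne_zero _ hx.ne'
    simp only [hφ]
    rw [eq_div_iff hxn, sub_mul, div_mul_cancel₀ _ hxn]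
    have := congrArg (eval x) (eraseLead_add_monomial_natDegree_leadingCoeff f)
    rw [eval_add, eval_monomial] at this
    rw [← hn] at this
    linarith
  obtain ⟨M₂, hM₂⟩ := exists_forall_ge_eval_pos f.eraseLead hElead
  set x₂ := max (ξ + 1) M₂ with hx₂
  have hx₂ξ : ξ < x₂ := lt_of_lt_of_le (by linarith) (le_max_left _ _)
  have hx₂0 : 0 < x₂ := hξ0.trans hx₂ξ
  have hover : f.leadingCoeff < φ x₂ := by
    have := hφa x₂ hx₂0
    have hpos : 0 < f.eraseLead.eval x₂ / x₂ ^ n := div_pos (hM₂ x₂ (le_max_right _ _)) (pow_pos hx₂0 n)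
    linarith
  -- `eraseLead f / X^n → 0`, so beyond some point `φ < φ x₂`
  have htend : Filter.Tendsto (fun x => f.eraseLead.eval x / (X ^ n : ℝ[X]).eval x) Filter.atTop (nhds 0) := by
    apply Polynomial.div_tendsto_atTop_zero_of_degree_lt
    rw [degree_X_pow]
    calc f.eraseLead.degree ≤ (f.eraseLead.natDegree : WithBot ℕ) := degree_le_natDegree
      _ < n := by rw [hEdeg']; exact_mod_cast (show n - m < n by omega)
  have hev : ∀ᶠ x in Filter.atTop, f.eraseLead.eval x / (X ^ n : ℝ[X]).eval x < φ x₂ - f.leadingCoeff :=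
    htend.eventually (gt_mem_nhds (by linarith))
  obtain ⟨M₃, hM₃⟩ := hev.exists_forall_of_atTop
  set x₃ := max (x₂ + 1) M₃ with hx₃
  have hx₂x₃ : x₂ < x₃ := lt_of_lt_of_le (by linarith) (le_max_left _ _)
  have hx₃0 : 0 < x₃ := hx₂0.trans hx₂x₃
  have hdown : φ x₃ < φ x₂ := by
    have h1 := hM₃ x₃ (le_max_right _ _)
    rw [eval_pow, eval_X] at h1
    have h2 := hφa x₃ hx₃0
    linarith
  obtain ⟨η, hη, hηslope⟩ := exists_deriv_eq_slope φ hx₂x₃ (hφcont x₂ x₃ hx₂0) (hφdiff x₂ x₃ hx₂0)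
  have hη0 : 0 < η := hx₂0.trans hη.1
  have hgη : g.eval η < 0 := by
    have hd := (hφderiv η hη0).deriv
    rw [hηslope] at hd
    have hneg : (φ x₃ - φ x₂) / (x₃ - x₂) < 0 := div_neg_of_neg_of_pos (by linarith) (by linarith)
    rw [hd] at hneg
    have hx1 : 0 < η ^ (n + 1) := pow_pos hη0 _
    by_contra hge; rw [not_lt] at hge
    have := div_nonneg hge hx1.le
    linarith
  -- (D) a root `z` of `g` in `(ξ, η)`, beyond `r`
  have hcontg : ContinuousOn (fun u => g.eval u) (Icc ξ η) := g.continuousOn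
  obtain ⟨z, hz, hgz⟩ := intermediate_value_Ioo' (hx₂ξ.trans hη.1).le hcontg ⟨hgη, hgξ⟩
  have hzr : r < z := hξ.1.trans hz.1
  have hzt : z ∈ t := (hmem_t z).mpr ⟨hgz, hr0.trans hzr⟩
  -- interleave `insert (z+1) s` with `t`
  set Mz := z + 1 with hMz
  have hMs : Mz ∉ s := fun hM => by have := hrmax Mz hM; linarith
  have key : (insert Mz s).card ≤ (t \ insert Mz s).card + 1 := by
    refine Finset.card_le_sdiff_of_interleaved fun x hx y hy hxy hno => ?_
    rw [Finset.mem_insert] at hx hy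
    rcases hy with rfl | hy
    · -- `y = Mz`: then `x = r` (no element of `s` lies in `(x, Mz)`), use `z`
      rcases hx with rfl | hx
      · exact absurd hxy (lt_irrefl _)
      have hxr : x = r := by
        rcases lt_or_eq_of_le (hrmax x hx) with hlt | heq
        · exfalso
          exact hno r (Finset.mem_insert_of_mem hrs) ⟨hlt, by linarith⟩
        · exact heq
      subst hxr
      exact ⟨z, hzt, hzr, by linarith⟩
    · rcases hx with rfl | hx
      · have := hrmax y hy; exact absurd hxy (by linarith)
      · have hxm := (hmem_s x).mp hx
        have hym := (hmem_s y).mp hy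
        obtain ⟨c, hc1, hc2, hgc⟩ := rolle x y hxm.2 hxy hxm.1 hym.1
        exact ⟨c, (hmem_t c).mpr ⟨hgc, hxm.2.trans hc1⟩, hc1, hc2⟩
  rw [Finset.card_insert_of_notMem hMs] at key
  have : (t \ insert Mz s).card ≤ t.card := Finset.card_le_card Finset.sdiff_subset
  omega

/-- **TOP-KILL LEMMA.**  For a real polynomial `f` of degree `n ≥ m ≥ 1` with `f.coeff j = 0` for
`n − m < j < n` and `f.leadingCoeff · f.coeff (n − m) > 0` (the two HIGHEST coefficients have the same sign), the
Euler twist at the top exponent loses no positive root: `#Z₊(f) ≤ #Z₊(X·f′ − n·f)`.  (The `x ↦ 1/x` mirror of the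
END-KILL lemma, proved directly: `f/xⁿ` overshoots its limit `leadingCoeff f` and returns, which costs the twist
a root beyond the largest root of `f`.) [folklore] -/
theorem card_posRoots_le_card_posRoots_topTwist_of_topKill (f : ℝ[X]) {m : ℕ} (hm : 1 ≤ m)
    (hmn : m ≤ f.natDegree) (hgap : ∀ j, f.natDegree - m < j → j < f.natDegree → f.coeff j = 0)
    (hsame : 0 < f.leadingCoeff * f.coeff (f.natDegree - m)) :
    (f.roots.toFinset.filter (fun x => 0 < x)).card ≤
      ((X * derivative f - C (f.natDegree : ℝ) * f).roots.toFinset.filter (fun x => 0 < x)).card := by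
  rcases lt_or_gt_of_ne (show f.leadingCoeff ≠ 0 from fun h0 => by
      rw [h0, zero_mul] at hsame; exact lt_irrefl 0 hsame) with hneg | hposc
  · have hb : f.coeff (f.natDegree - m) < 0 := by
      by_contra hc; rw [not_lt] at hc
      have := mul_nonpos_of_nonpos_of_nonneg hneg.le hc; linarith
    have h1 := card_posRoots_le_card_posRoots_topTwist_of_topKill_pos (-f) hm
      (by rw [natDegree_neg]; exact hmn)
      (fun j hj1 hj2 => by
        rw [natDegree_neg] at hj1 hj2; rw [coeff_neg, hgap j hj1 hj2, neg_zero])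
      (by rw [leadingCoeff_neg]; linarith) (by rw [natDegree_neg, coeff_neg]; linarith)
    rw [natDegree_neg, roots_neg, derivative_neg] at h1
    have e : (X * -derivative f - C (f.natDegree : ℝ) * -f) = -(X * derivative f - C (f.natDegree : ℝ) * f) := by
      ring
    rwa [e, roots_neg] at h1
  · have hb : 0 < f.coeff (f.natDegree - m) := by
      by_contra hc; rw [not_lt] at hc
      have := mul_nonpos_of_nonneg_of_nonpos hposc.le hc; linarith
    exact card_posRoots_le_card_posRoots_topTwist_of_topKill_pos f hm hmn hgap hposc hb

/-- The adjacent-coefficient case `m = 1` of the TOP-KILL lemma (no gap hypothesis to check): if `f` is not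
constant and its two HIGHEST coefficients have the same sign, `f.leadingCoeff · f.coeff (n − 1) > 0` with
`n = f.natDegree`, then the Euler twist at the top exponent loses no positive root: `#Z₊(f) ≤ #Z₊(X·f′ − n·f)`.
[folklore] -/
theorem card_posRoots_le_card_posRoots_topTwist_of_leadingCoeff_mul_coeff_pos (f : ℝ[X])
    (hn : 1 ≤ f.natDegree) (hsame : 0 < f.leadingCoeff * f.coeff (f.natDegree - 1)) :
    (f.roots.toFinset.filter (fun x => 0 < x)).card ≤
      ((X * derivative f - C (f.natDegree : ℝ) * f).roots.toFinset.filter (fun x => 0 < x)).card :=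
  card_posRoots_le_card_posRoots_topTwist_of_topKill f le_rfl hn (fun j hj1 hj2 => by omega) hsame

end Summit.ValiantsHypothesis.ValiantsHypothesis.Theorems.LacunarySymmetroidMatrixDescartes.Census
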